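import Literature.IUT.HodgeArakelov.PlusMinusTowerStableCurveBridge
import Literature.IUT.HodgeTheaters.TemperedCoveringsProofs
import HarnessLib

/-!
# Bridge B13, input (A) of [IUTchII] Cor 2.4 (i) at the node's `Π_v`-cuspidal inertia group `I_t`

Mochizuki, *Inter-universal Teichmüller Theory II*, kurims manuscript (Dec. 2020), §2, Def 2.3 (ii)–(iii) p.68,
Cor 2.4 (i) and its proof, p.70 l.−6 – p.71 l.5, Rmk 2.4.1 p.71; *Inter-universal Teichmüller Theory I*,
kurims manuscript (May 2020), §2, Prop 2.4 (i) p.50, Cor 2.5 and its proof p.51, Rmk 2.5.2 p.52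
[cite: Mochizuki2012, II Cor 2.4 (i) pp.70–71, I Cor 2.5 p.51] (D-0012 claim key, status disputed; PROOF-ONLY
companion of abc-iut-L6-t7's bridge `PlusMinusTowerStableCurveBridge` (B13) — no definition, nothing of the series
is asserted: every printed input is a hypothesis named by the tree's L5/L6 declarations).

WHY THIS FILE (audit finding W5d121-F1 on p412701, abc-iut-w5-d121).  The bridge's
`PlusMinusTower.StableCurveAgreement.h25` delivers input (A) of the printed proof of Cor 2.4 (i) — "by [IUTchI],
Corollary 2.5 [cf. also [IUTchI], Remark 2.5.2], the inclusion `I^{γ'}_t ⊆ Π^±_{v□} ⊆ Π^±_v` implies that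
`γ' ∈ Δ^±_v`" — for a cuspidal inertia group `I` OF `Π^±_v` (`C.IsCuspidalInertia W.piPM I`), via abc-iut-L5-t1's
`StableCurveTemperedData.Cor25Inertia` (full representative inertia groups `I_x`).  The node's subject, however, is
print's "`I_t ⊆ Π_v` a cuspidal inertia group" of `Π_v = Π^tp_{X̲̲_v}` (the antecedent `C.IsCuspidalInertia W.piV I`
of abc-iut-L6-t1's `Cor24_i`, decl of record `Cor24_i'`), and by Def 2.3 (ii)/(iii) p.68 ("the inclusion
`Π_⊆ ⊆ Π_⊇` corresponds to a totally ramified covering"; "the cuspidal inertia groups of `Π_⊆` may be obtained as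
the intersections with `Π_⊆` of those cuspidal inertia groups of `Π_⊇` that contain a finite index subgroup that
lies inside `Π_⊆`") such an `I_t` is a FINITE-INDEX subgroup `I' ∩ Π_v` of a cuspidal inertia group `I'` of
`Π^±_v`, not a `Π^tp_{X_v}`-conjugate of a full `I_x`.  What the printed proof actually uses there is the METHOD of
the proof of [IUTchI] Cor 2.5 for cusps (p.51: "by applying Proposition 2.4, (i), to the unique maximal pro-`Σ`
subgroup of `I_x`"; Rmk 2.5.2 p.52; [IUTchII] Rmk 2.4.1 p.71), which applies verbatim to finite-index subgroups.
This file kernel-checks exactly that route: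

* `StableCurveTemperedData.conj_range_eq_of_proSigma_le` — [IUTchI] Prop 2.4 (i) (`D.Prop24i`, HYPOTHESIS)
  ⟹ a `Π̂_X`-conjugate of `Π^tp_X` containing ANY nontrivial compact pro-`Σ` subgroup of `Δ^tp_X` equals `Π^tp_X`
  (abc-iut-L5-t11's `cor25Inertia_of_prop24i`, second clause, with `I_x` replaced by its pro-`Σ` part);
* `PlusMinusTower.StableCurveAgreement.conj_piPM_eq_iff` — under the agreement, for `γ ∈ Π̂^±_v`:
  `(Π^±_v)^γ = Π^±_v ↔ (Π^tp_{X_v})^{eHat γ} = Π^tp_{X_v}` (transport);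
* `PlusMinusTower.StableCurveAgreement.inputA1_of_prop24i` — input (A1) of abc-iut-w4-d012's `cor24_i'_of_inputs'`
  ("a `Π̂^±_v`-conjugate of `Π^±_v` containing `I_t` equals `Π^±_v`") AT a `Π_v`-cuspidal `I_t`, from: the agreement,
  `D.Prop24i`, abc-iut-L6-t1's Def 2.3 (ii) relation `Def23_ii C W.piV W.piPM`, and the pro-`Σ` datum in
  abc-iut-L5-t11's shape extended to finite-index subgroups of the `Π^tp`-conjugates of the `I_x` (at the model:
  `J ∩ ℤ_l(1)`), all HYPOTHESES;
* `….inputA2_of_normallyTerminal` — (A2) "(`Π^±_v`)^γ = `Π^±_v` ⟹ `γ ∈ Π^±_v`" from the normal terminality of `Π^tp_{X_v}` in `Π̂_{X_v}`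
  ([IUTchI] Prop 2.4 (iii), `D.Prop24iii`, HYPOTHESIS);
* `….h25_piV` — the binder `h25` of `cor24_i_of_inputs` (LabelClassesOfCuspsCor24iProofs.lean) VERBATIM, for the
  node's `Π_v`-cuspidal `I`.

HONEST FRAMING: a kernel check of a deduction between typed statements over abstract data; typed ≠ proved for the
series; nothing here bears on [IUTchIII] Cor 3.12.
-/

namespace Literature.IUT.HodgeTheaters

namespace StableCurveTemperedData

open scoped Pointwise
open Literature.AnabelianGeometry.SemiGraphs (IsProSigma)

universe u

variable (D : StableCurveTemperedData.{u})

/-- **[IUTchI] Cor 2.5, proof for cusps, in the generality it is proved** (kurims p.51: "by applying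
Proposition 2.4, (i), to the unique maximal pro-`Σ` subgroup of `I_x` … a `Π̂_X`-conjugate of `Π^tp_X` contains
`I_x` if and only if it is, in fact, equal to `Π^tp_X`"): GIVEN Prop 2.4 (i) for the data `D` (hypothesis `h`),
a `Π̂_X`-conjugate `(Π^tp_X)^γ` of `Π^tp_X` that contains a nontrivial compact pro-`Σ` subgroup `P ⊆ Δ^tp_X` is
equal to `Π^tp_X`.  (abc-iut-L5-t11's `cor25Inertia_of_prop24i`, clause `conj_eq_iff`, uses exactly this with
`P ⊆ I_x`; here `P` is arbitrary, so the statement serves every finite-index subgroup of a cuspidal inertia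
group — the form [IUTchII] Cor 2.4 (i) p.70 "[cf. also [IUTchI], Remark 2.5.2]" and Rmk 2.4.1 p.71 invoke.)
[claim: Mochizuki2012, status: disputed] -/
theorem conj_range_eq_of_proSigma_le (h : D.Prop24i) (P : Subgroup D.DeltaTp)
    (hPc : IsCompact (P : Set D.DeltaTp)) (hPne : P ≠ ⊥) (hPS : IsProSigma D.graph.Sigma P)
    (γ : D.PiHat) (hle : (P.map D.DeltaTp.subtype).map D.ιX ≤ MulAut.conj γ • D.ιX.range) :
    MulAut.conj γ • D.ιX.range = D.ιX.range := by
  -- apply Prop. 2.4 (i) to `Λ = P` and the element `γ⁻¹`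
  have hγ' : γ⁻¹ ∈ D.ιX.range := by
    refine h.mem_of_conj_le P hPc hPne hPS γ⁻¹ fun p hp => ?_
    refine D.conj_mem_map_deltaTp (by rw [D.prHat_ιX]; exact p.2) ?_
    have hmem : D.ιX (p : D.PiTp) ∈ MulAut.conj γ • D.ιX.range :=
      hle ⟨(p : D.PiTp), ⟨p, hp, rfl⟩, rfl⟩
    rw [Subgroup.mem_pointwise_smul_iff_inv_smul_mem, MulAut.smul_def, MulAut.conj_inv_apply] at hmem
    simpa only [inv_inv] using hmem
  exact Subgroup.conj_smul_eq_self_of_mem ((Subgroup.inv_mem_iff _).mp hγ')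

end StableCurveTemperedData

end Literature.IUT.HodgeTheaters

namespace Literature.IUT.HodgeArakelov

open Literature.IUT.HodgeTheaters
open Literature.AnabelianGeometry.AbsoluteAnabelian (IsNormallyTerminal)
open Literature.AnabelianGeometry.SemiGraphs (IsProSigma)
open scoped Pointwise

universe u

variable {S : BadPlaceSetting.{u}} {P : TopGroup.{u}} {T : TemperedCoverings S P}

namespace PlusMinusTower

namespace StableCurveAgreement

variable {W : PlusMinusTower T} {C : CuspidalInertiaData W} {D : StableCurveTemperedData.{u}}

/-- **IUTchII:Def2.3(i)** (kurims p.67) Conjugation inside `Π̂^±_v` is carried by `eHat` to conjugation inside `Π̂_{X_v}` (pointwise).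
[claim: Mochizuki2012, status: disputed] -/
theorem eHat_conj (A : StableCurveAgreement W C D) {γ q : W.Corhat} (hγ : γ ∈ W.pmHat) (hq : q ∈ W.pmHat) :
    A.eHat ⟨γ * q * γ⁻¹, W.pmHat.mul_mem (W.pmHat.mul_mem hγ hq) (W.pmHat.inv_mem hγ)⟩ =
      A.eHat ⟨γ, hγ⟩ * A.eHat ⟨q, hq⟩ * (A.eHat ⟨γ, hγ⟩)⁻¹ := by
  rw [← map_inv, ← map_mul, ← map_mul]
  rfl

/-- **IUTchII:Def2.3(i)** (kurims p.67) The inverse direction of `eHat_conj`: `eHat (γ⁻¹ q γ) = (eHat γ)⁻¹ · eHat q · eHat γ`.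
[claim: Mochizuki2012, status: disputed] -/
theorem eHat_conj_inv (A : StableCurveAgreement W C D) {γ q : W.Corhat} (hγ : γ ∈ W.pmHat)
    (hq : q ∈ W.pmHat) :
    A.eHat ⟨γ⁻¹ * q * γ, W.pmHat.mul_mem (W.pmHat.mul_mem (W.pmHat.inv_mem hγ) hq) hγ⟩ =
      (A.eHat ⟨γ, hγ⟩)⁻¹ * A.eHat ⟨q, hq⟩ * A.eHat ⟨γ, hγ⟩ := by
  rw [← map_inv, ← map_mul, ← map_mul]
  rfl

/-- **IUTchII:Def2.3(i)** (kurims p.67) TRANSPORT of "`(Π^±_v)^γ = Π^±_v`" along the agreement: for `γ ∈ Π̂^±_v` with image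
`g := eHat γ ∈ Π̂_{X_v}`, the conjugate `(Π^±_v)^γ` equals `Π^±_v` iff `(Π^tp_{X_v})^g = Π^tp_{X_v}` inside `Π̂_{X_v}`.
PROVED (elementwise, using `map_piPM`). [claim: Mochizuki2012, status: disputed] -/
theorem conj_piPM_eq_iff (A : StableCurveAgreement W C D) {γ : W.Corhat} (hγ : γ ∈ W.pmHat) :
    W.piPM.map (MulAut.conj γ).toMonoidHom = W.piPM ↔
      MulAut.conj (A.eHat ⟨γ, hγ⟩) • D.ιX.range = D.ιX.range := by
  constructor
  · intro hE
    ext z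
    obtain ⟨q, rfl⟩ := A.eHat.surjective z
    rw [Subgroup.mem_pointwise_smul_iff_inv_smul_mem, MulAut.smul_def, MulAut.conj_inv_apply,
      ← A.eHat_conj_inv hγ q.2, ← A.mem_piPM_iff, ← A.mem_piPM_iff]
    -- `γ⁻¹ q γ ∈ Π^±_v ↔ q ∈ (Π^±_v)^γ = Π^±_v`
    conv_rhs => rw [← hE]
    rw [Subgroup.mem_map_equiv, MulAut.conj_symm_apply]
  · intro hE
    ext y
    rw [Subgroup.mem_map_equiv, MulAut.conj_symm_apply]
    by_cases hy : y ∈ W.pmHat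
    · have hy' : γ⁻¹ * y * γ ∈ W.pmHat := W.pmHat.mul_mem (W.pmHat.mul_mem (W.pmHat.inv_mem hγ) hy) hγ
      rw [A.mem_piPM_iff ⟨_, hy'⟩, A.mem_piPM_iff ⟨y, hy⟩, A.eHat_conj_inv hγ hy, ← MulAut.conj_inv_apply,
        ← MulAut.smul_def, ← Subgroup.mem_pointwise_smul_iff_inv_smul_mem, hE]
    · -- outside `Π̂^±_v` both sides fail, since `Π^±_v ⊆ Π̂^±_v ∋ γ`
      have h1 : γ⁻¹ * y * γ ∉ W.piPM := fun h => hy <| by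
        have h' := W.pmHat.mul_mem (W.pmHat.mul_mem hγ (W.emb_le_pmHat h)) (W.pmHat.inv_mem hγ)
        have e : γ * (γ⁻¹ * y * γ) * γ⁻¹ = y := by group
        rwa [e] at h'
      exact ⟨fun h => absurd h h1, fun h => absurd (W.emb_le_pmHat h) hy⟩

/-- **IUTchI:Cor2.5** (kurims p.51) **Input (A1) of [IUTchII] Cor 2.4 (i) at the node's `Π_v`-cuspidal inertia group.**  For a cuspidal
inertia group `I ⊆ Π_v` OF `Π_v` (`C.IsCuspidalInertia W.piV I` — print's "`I_t ⊆ Π_v`", Cor 2.4 p.69), and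
`γ ∈ Π̂^±_v`: if `I ⊆ (Π^±_v)^γ` then `(Π^±_v)^γ = Π^±_v` — the shape `hA1` of abc-iut-w4-d012's
`cor24_i'_of_inputs'`.  HYPOTHESES (all named, none asserted): the B13 agreement `A`; [IUTchI] Prop 2.4 (i) for
`X_v` (`D.Prop24i`); [IUTchII] Def 2.3 (ii) for `Π_v ⊆ Π^±_v` (abc-iut-L6-t1's `Def23_ii C W.piV W.piPM`:
`I = I' ∩ Π_v` of finite index in a cuspidal inertia group `I'` of `Π^±_v`); and the pro-`Σ` datum `hP` — every
finite-index subgroup `J` of a `Π^tp_{X_v}`-conjugate of a representative inertia group `I_x` contains a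
nontrivial compact pro-`Σ` subgroup of `Δ^tp_{X_v}` ("the unique maximal pro-`Σ` subgroup", [IUTchI] p.51;
abc-iut-L5-t11's `cor25Inertia_of_prop24i` binder, extended to finite-index subgroups).  PROVED along the printed
route ([IUTchII] p.70 "[cf. also [IUTchI], Remark 2.5.2]"). [claim: Mochizuki2012, status: disputed] -/
theorem inputA1_of_prop24i (A : StableCurveAgreement W C D) (h24i : D.Prop24i)
    (hrel : Def23_ii C W.piV W.piPM)
    (hP : ∀ (x : D.Cusp) (t : D.PiTp) (J : Subgroup D.PiHat),
      J ≤ (MulAut.conj t • (D.inertiaTp x).map D.DeltaTp.subtype).map D.ιX →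
      (J.subgroupOf ((MulAut.conj t • (D.inertiaTp x).map D.DeltaTp.subtype).map D.ιX)).FiniteIndex →
        ∃ Q : Subgroup D.DeltaTp, (Q.map D.DeltaTp.subtype).map D.ιX ≤ J ∧
          IsCompact (Q : Set D.DeltaTp) ∧ Q ≠ ⊥ ∧ IsProSigma D.graph.Sigma Q)
    {I : Subgroup W.Corhat} (hI : C.IsCuspidalInertia W.piV I) :
    ∀ γ : W.Corhat, γ ∈ W.pmHat → I ≤ W.piPM.map (MulAut.conj γ).toMonoidHom →
      W.piPM.map (MulAut.conj γ).toMonoidHom = W.piPM := by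
  intro γ hγ hc
  -- Def 2.3 (ii): `I = I' ∩ Π_v`, finite index in a cuspidal inertia group `I'` of `Π^±_v`
  obtain ⟨I', hI', hfi, rfl⟩ := (hrel.2.1 I).mp hI
  -- the agreement: `I' ⊆ Π^±_v` is carried onto a `Π^tp_{X_v}`-conjugate of some `I_x`
  obtain ⟨hI'pm, x, t, hK⟩ := (A.inertia_iff I').mp hI'
  have hI'hat : I' ≤ W.pmHat := hI'pm.trans W.emb_le_pmHat
  set g : D.PiHat := A.eHat ⟨γ, hγ⟩ with hg
  set K : Subgroup D.PiHat := (MulAut.conj t • (D.inertiaTp x).map D.DeltaTp.subtype).map D.ιX with hKdef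
  set J : Subgroup D.PiHat := ((I' ⊓ W.piV).subgroupOf W.pmHat).map A.eHat.toMonoidHom with hJ
  -- `J ⊆ K`, of finite index
  have hJK : J ≤ K := by
    rw [hJ, ← hK]
    exact map_subgroupOf_mono A.eHat inf_le_left
  have hJfi : (J.subgroupOf K).FiniteIndex := by
    refine ⟨?_⟩
    change J.relIndex K ≠ 0
    rw [hJ, ← hK, Subgroup.relIndex_map_map_of_injective _ _ A.eHat.injective,
      Subgroup.relIndex_subgroupOf hI'hat]
    exact hfi.index_ne_zero
  -- `J ⊆ (Π^tp_{X_v})^g`, transported from `I' ∩ Π_v ⊆ (Π^±_v)^γ`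
  have hJg : J ≤ MulAut.conj g • D.ιX.range := by
    rintro _ ⟨q, hq, rfl⟩
    have hqI : (q : W.Corhat) ∈ I' ⊓ W.piV := Subgroup.mem_subgroupOf.mp hq
    have hq' : γ⁻¹ * (q : W.Corhat) * γ ∈ W.piPM := by
      have := hc hqI
      rwa [Subgroup.mem_map_equiv, MulAut.conj_symm_apply] at this
    rw [Subgroup.mem_pointwise_smul_iff_inv_smul_mem, MulAut.smul_def, MulAut.conj_inv_apply,
      MulEquiv.coe_toMonoidHom, hg, ← A.eHat_conj_inv hγ q.2]
    exact (A.mem_piPM_iff ⟨_, _⟩).mp hq'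
  -- the pro-`Σ` part of `J`, then Prop 2.4 (i)
  obtain ⟨Q, hQJ, hQc, hQne, hQS⟩ := hP x t J hJK hJfi
  have heq : MulAut.conj g • D.ιX.range = D.ιX.range :=
    D.conj_range_eq_of_proSigma_le h24i Q hQc hQne hQS g (hQJ.trans hJg)
  exact (A.conj_piPM_eq_iff hγ).mpr heq

/-- **IUTchI:Prop2.4(iii)** (kurims p.50) **Input (A2) of [IUTchII] Cor 2.4 (i)**: for `γ ∈ Π̂^±_v`, `(Π^±_v)^γ = Π^±_v` implies `γ ∈ Π^±_v` — from the
normal terminality of `Π^tp_{X_v}` in `Π̂_{X_v}` (HYPOTHESIS `hNT`; e.g. `D.Prop24iii.pi.isNormallyTerminal`),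
transported along the agreement; the shape `hA2` of abc-iut-w4-d012's `cor24_i'_of_inputs'`. PROVED.
[claim: Mochizuki2012, status: disputed] -/
theorem inputA2_of_normallyTerminal (A : StableCurveAgreement W C D) (hNT : IsNormallyTerminal D.ιX.range) :
    ∀ γ : W.Corhat, γ ∈ W.pmHat → W.piPM.map (MulAut.conj γ).toMonoidHom = W.piPM → γ ∈ W.piPM := by
  intro γ hγ hE
  have heq := (A.conj_piPM_eq_iff hγ).mp hE
  exact (A.mem_piPM_iff ⟨γ, hγ⟩).mpr (mem_of_conj_smul_eq hNT heq)

/-- **IUTchII:Cor2.4(i)** (kurims p.70 l.−3) **The binder `h25` of `cor24_i_of_inputs` at the node's `Π_v`-cuspidal `I`** — "by [IUTchI],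
Corollary 2.5 [cf. also [IUTchI], Remark 2.5.2], the inclusion `I^{γ'}_t ⊆ Π^±_{v□} ⊆ Π^±_v` implies that
`γ' ∈ Δ^±_v`": for `γ' ∈ Δ̂^±_v`, `I^{γ'} ⊆ Π^±_v ⟹ γ' ∈ Π^±_v`.  From `inputA1_of_prop24i` (applied to `γ'⁻¹`) and
`inputA2_of_normallyTerminal`; hypotheses as there plus `hNT`.  PROVED. [claim: Mochizuki2012, status: disputed] -/
theorem h25_piV (A : StableCurveAgreement W C D) (h24i : D.Prop24i) (hNT : IsNormallyTerminal D.ιX.range)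
    (hrel : Def23_ii C W.piV W.piPM)
    (hP : ∀ (x : D.Cusp) (t : D.PiTp) (J : Subgroup D.PiHat),
      J ≤ (MulAut.conj t • (D.inertiaTp x).map D.DeltaTp.subtype).map D.ιX →
      (J.subgroupOf ((MulAut.conj t • (D.inertiaTp x).map D.DeltaTp.subtype).map D.ιX)).FiniteIndex →
        ∃ Q : Subgroup D.DeltaTp, (Q.map D.DeltaTp.subtype).map D.ιX ≤ J ∧
          IsCompact (Q : Set D.DeltaTp) ∧ Q ≠ ⊥ ∧ IsProSigma D.graph.Sigma Q)
    {I : Subgroup W.Corhat} (hI : C.IsCuspidalInertia W.piV I) :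
    ∀ γ' : W.Corhat, γ' ∈ W.pmHat ⊓ W.aug.ker →
      I.map (MulAut.conj γ').toMonoidHom ≤ W.piPM → γ' ∈ W.piPM := by
  intro γ' hγ' hc
  have hγ'hat : γ'⁻¹ ∈ W.pmHat := W.pmHat.inv_mem (Subgroup.mem_inf.mp hγ').1
  -- `I^{γ'} ⊆ Π^±_v` is `I ⊆ (Π^±_v)^{γ'⁻¹}`
  have hI' : I ≤ W.piPM.map (MulAut.conj γ'⁻¹).toMonoidHom := by
    intro x hx
    rw [Subgroup.mem_map_equiv, MulAut.conj_symm_apply, inv_inv]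
    exact hc ⟨x, hx, rfl⟩
  have hE := A.inputA1_of_prop24i h24i hrel hP hI γ'⁻¹ hγ'hat hI'
  exact (Subgroup.inv_mem_iff W.piPM).mp (A.inputA2_of_normallyTerminal hNT γ'⁻¹ hγ'hat hE)

/-- **IUTchII:Cor2.4(i)** (kurims pp.70–71) `h25_piV` with the normal terminality supplied by abc-iut-L5-t1's typed [IUTchI] Prop 2.4 (iii)
(`D.Prop24iii`). PROVED. [claim: Mochizuki2012, status: disputed] -/
theorem h25_piV_of_prop24iii (A : StableCurveAgreement W C D) (h24i : D.Prop24i) (h24iii : D.Prop24iii)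
    (hrel : Def23_ii C W.piV W.piPM)
    (hP : ∀ (x : D.Cusp) (t : D.PiTp) (J : Subgroup D.PiHat),
      J ≤ (MulAut.conj t • (D.inertiaTp x).map D.DeltaTp.subtype).map D.ιX →
      (J.subgroupOf ((MulAut.conj t • (D.inertiaTp x).map D.DeltaTp.subtype).map D.ιX)).FiniteIndex →
        ∃ Q : Subgroup D.DeltaTp, (Q.map D.DeltaTp.subtype).map D.ιX ≤ J ∧
          IsCompact (Q : Set D.DeltaTp) ∧ Q ≠ ⊥ ∧ IsProSigma D.graph.Sigma Q)
    {I : Subgroup W.Corhat} (hI : C.IsCuspidalInertia W.piV I) :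
    ∀ γ' : W.Corhat, γ' ∈ W.pmHat ⊓ W.aug.ker →
      I.map (MulAut.conj γ').toMonoidHom ≤ W.piPM → γ' ∈ W.piPM :=
  A.h25_piV h24i h24iii.pi.isNormallyTerminal hrel hP hI

end StableCurveAgreement

end PlusMinusTower

end Literature.IUT.HodgeArakelov
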